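import Summits.KontsevichZagierPeriods.KontsevichZagierPeriods.Theorems.RootDecompWalshStrataParab4Rung
import Summits.KontsevichZagierPeriods.KontsevichZagierPeriods.Theorems.RootDecompWalshStrataBall4Disc
import Summits.KontsevichZagierPeriods.KontsevichZagierPeriods.Theorems.RootDecompWalshStrataBakerAt

/-!
# The solid paraboloid has weight one: descent to the Baker sector

Route `RootDecompWalshStrata` (cell decomp-kz, lens 4, gen 11), support toward `QuadricSignKernel`
(item stmt-KontsevichZagierPeriods-25393).  `RootDecompWalshStrataParab4Descent` descends the paraboloid
4-cell `[(0,1)⁴ ∩ {x₃ > x₀² + x₁² + x₂²}, q]` (value `q·π/15`) inside the rules to the rational 2-cell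
`S₂ = [(0,1)², q(1 − t₀²)²/(4((1 − t₁)² + t₁²))]`.  Its weight is a PRODUCT with a polynomial factor,
so one more round lands in dimension ONE: swap the coordinates (rule (2), `KZ.permRel`), then
Newton–Leibniz along the polynomial variable with the primitive `q(15t − 10t³ + 3t⁵)/(60((1 − v)² + v²))`
over `(0,1)` (rule (3); `∫₀¹ (1 − t²)² dt = 8/15`) and open the fibres (rule (1a)):
`S₂ ≡ arcRep (4q/15) = [(0,1), (4q/15)/(2((1 − v)² + v²))]`, a RATIONAL 1-cell.  Hence
`bakerDescentAt_parab4 : QuadricBakerDescentAt parab4Poly` — the paraboloid is in the weight-one class,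
DECIDED by Baker (`BakerAt.sum_mem_relations_of_bakerDescentAt_single`).  0 sorry.
[KontsevichZagier2001 §1.2 rules (1)–(3); Baker1975 Thm 2.1]
-/

noncomputable section

open Literature.NumberTheory.Transcendental
open MeasureTheory Set
open MvPolynomial (aeval X C)
open Literature.ModelTheory.ExponentialFields (IsSemialgebraic isSemialgebraic_setOf_eval_pos)
open Summit.KontsevichZagierPeriods.RootDecompWalshStrata.WalshSpanProof (isSemialgebraic_cubeSet
  isBounded_cubeSet cellRep cellRep_domain cellRep_integrand)
open Summit.KontsevichZagierPeriods.RootDecompWalshStrata.Ball4 (sqSet isSemialgebraic_sqSet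
  sqSet_subset_Icc ivSet isSemialgebraic_ivSet ivSet_subset_Icc arcRep arcRep_domain arcRep_integrand
  isRational_arcRep half_le_gq)
open Summit.KontsevichZagierPeriods.RootDecompWalshStrata.BakerAt (QuadricBakerDescentAt
  bakerDescentAt_of_cellRep sum_mem_relations_of_bakerDescentAt_single)
open Summit.KontsevichZagierPeriods.RootDecompWalshStrata.QuadricFourRung (totalDegree_parab4Poly_le)

namespace Summit.KontsevichZagierPeriods.RootDecompWalshStrata.Parab4

/-- `(1 − v)² + v² > 0` (from the landed bound `half_le_gq`). [folklore] -/
private theorem gPos (v : ℝ) : 0 < (1 - v) ^ 2 + v ^ 2 := one_half_pos.trans_le (half_le_gq v)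

/-- Last coordinate of `Fin.snoc` on `ℝ¹ × ℝ`. [definition] -/
private theorem snoc_one_eq (t : Fin 1 → ℝ) (s : ℝ) : (Fin.snoc t s : Fin 2 → ℝ) 1 = s := rfl

/-- First coordinate of `Fin.snoc` on `ℝ¹ × ℝ`. [definition] -/
private theorem snoc_zero_eq (t : Fin 1 → ℝ) (s : ℝ) : (Fin.snoc t s : Fin 2 → ℝ) 0 = t 0 := rfl

/-! #### Move (2): swap the two coordinates of `S₂` -/

/-- The swapped representation `S₂' = S₂.reindex (swap 0 1)` has domain `(0,1)²`. [definition] -/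
theorem swap_pSqRep_domain (q : ℚ) :
    ((pSqRep q).reindex (Equiv.swap 0 1)).domain = sqSet := by
  ext t
  simp only [KZ.IntegralRep.reindex_domain, pSqRep_domain, sqSet, mem_setOf_eq]
  exact (Equiv.swap (0 : Fin 2) 1).forall_congr_right (q := fun j => 0 < t j ∧ t j < 1)

/-- The swapped weight `q(1 − t₁²)²/(4((1 − t₀)² + t₀²))`. [definition] -/
theorem swap_pSqRep_integrand (q : ℚ) (t : Fin 2 → ℝ) :
    ((pSqRep q).reindex (Equiv.swap 0 1)).integrand t =
      (q : ℝ) * (1 - t 1 ^ 2) ^ 2 / (4 * ((1 - t 0) ^ 2 + t 0 ^ 2)) := by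
  simp [KZ.IntegralRep.reindex_integrand, pSqRep_integrand, Equiv.swap_apply_left,
    Equiv.swap_apply_right]

/-- **Move (2):** `[S₂] − [S₂'] ∈ KZ.relations` (coordinate swap, `KZ.permRel`).
[KontsevichZagier2001 §1.2 rule (2)] -/
theorem of_pSqRep_sub_of_swap_mem_relations (q : ℚ) :
    KZ.of (pSqRep q) - KZ.of ((pSqRep q).reindex (Equiv.swap 0 1)) ∈ KZ.relations :=
  KZ.permRel_subset_relations (KZ.of_sub_of_reindex_mem_permRel _ _)

/-! #### Moves (3) + (1a): `S₂' ≡ arcRep (4q/15)` -/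

/-- Membership in `(0,1)²` in band form over `(0,1)`. [folklore] -/
theorem mem_sqSet_iff_init (t : Fin 2 → ℝ) :
    t ∈ sqSet ↔ Fin.init t ∈ ivSet ∧ 0 < t (Fin.last 1) ∧ t (Fin.last 1) < 1 := by
  have hiv : Fin.init t ∈ ivSet ↔ (0 < t 0 ∧ t 0 < 1) := by
    simp only [ivSet, mem_setOf_eq, Fin.init]
    exact ⟨fun hu => hu 0, fun h0 j => by fin_cases j; exact h0⟩
  have hl : t (Fin.last 1) = t 1 := rfl
  rw [hiv, hl]
  simp only [sqSet, mem_setOf_eq, Fin.forall_fin_two]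

/-- The closed band `(0,1) × [0,1]` lies in `[0,1]²`. [folklore] -/
theorem band_ivSet_unit_subset_Icc :
    KZlog.band ivSet (fun _ => (0:ℝ)) (fun _ => (1:ℝ)) ⊆ Icc 0 1 := by
  intro y hy
  rw [KZlog.mem_band] at hy
  obtain ⟨hu, h0, h1⟩ := hy
  refine ⟨fun j => ?_, fun j => ?_⟩
  · fin_cases j
    · exact (hu 0).1.le
    · exact h0
  · fin_cases j
    · exact (hu 0).2.le
    · exact h1

/-- The swapped weight is continuous on `ℝ²`. [folklore] -/
theorem continuous_swapWeight (q : ℚ) :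
    Continuous fun t : Fin 2 → ℝ => (q : ℝ) * (1 - t 1 ^ 2) ^ 2 / (4 * ((1 - t 0) ^ 2 + t 0 ^ 2)) := by
  refine (continuous_const.mul ((continuous_const.sub ((continuous_apply 1).pow 2)).pow 2)).div
    ?_ fun t => (mul_pos four_pos (gPos (t 0))).ne'
  exact continuous_const.mul (((continuous_const.sub (continuous_apply 0)).pow 2).add
    ((continuous_apply 0).pow 2))

/-- **Moves (3) + (1a):** Newton–Leibniz along `t₁` with the primitive
`q(15t₁ − 10t₁³ + 3t₁⁵)/(60((1 − t₀)² + t₀²))` over `(0,1)` (closed fibres `[0,1]`,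
`∫₀¹ (1 − t²)² dt = 8/15`), then opening the fibres: `[S₂'] − arcRep (4q/15) ∈ KZ.relations` (`2 → 1`).
[KontsevichZagier2001 §1.2 rules (1), (3)] -/
theorem of_swap_sub_of_arcRep_mem_relations (q : ℚ) :
    KZ.of ((pSqRep q).reindex (Equiv.swap 0 1)) - KZ.of (arcRep (4 * q / 15)) ∈ KZ.relations := by
  have hBs := isSemialgebraic_ivSet
  have ha : IsSemialgebraicFunOn ℚ ivSet (fun _ => (0:ℝ)) := by
    simpa using isSemialgebraicFunOn_ratCast hBs 0
  have hb : IsSemialgebraicFunOn ℚ ivSet (fun _ => (1:ℝ)) := by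
    simpa using isSemialgebraicFunOn_ratCast hBs 1
  have hband : IsSemialgebraic ℚ (KZlog.band ivSet (fun _ => (0:ℝ)) fun _ => (1:ℝ)) :=
    KZlog.isSemialgebraic_band ha hb
  set F : (Fin 2 → ℝ) → ℝ := fun y =>
    (q : ℝ) * (15 * y 1 - 10 * y 1 ^ 3 + 3 * y 1 ^ 5) / (60 * ((1 - y 0) ^ 2 + y 0 ^ 2)) with hFdef
  have hbdry : ∀ t ∈ ivSet,
      F (Fin.snoc t ((fun _ => (1:ℝ)) t)) - F (Fin.snoc t ((fun _ => (0:ℝ)) t)) =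
        (arcRep (4 * q / 15)).integrand t := by
    intro t _
    simp only [hFdef, snoc_one_eq, snoc_zero_eq, arcRep_integrand]
    have hG0 := (gPos (t 0)).ne'
    push_cast
    field_simp
    ring
  obtain ⟨rb, rd, hrbd, hrbi, hrdd, hrdi, hrel⟩ := KZ.exists_band_newtonLeibniz hBs
    (fun _ => (0:ℝ)) (fun _ => (1:ℝ)) ha hb (fun _ _ => zero_le_one) F
    (fun y => (q : ℝ) * (1 - y 1 ^ 2) ^ 2 / (4 * ((1 - y 0) ^ 2 + y 0 ^ 2)))
    ((isSemialgebraicFunOn_aeval_div_aeval hband (C q * (15 * X 1 - 10 * X 1 ^ 3 + 3 * X 1 ^ 5))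
      (60 * ((1 - X 0) ^ 2 + X 0 ^ 2)) fun y _ => by
        simpa using (mul_pos (by norm_num : (0:ℝ) < 60) (gPos (y 0))).ne').congr fun y _ => by
        simp only [hFdef]
        simp)
    ((isSemialgebraicFunOn_aeval_div_aeval hband (C q * (1 - X 1 ^ 2) ^ 2)
      (4 * ((1 - X 0) ^ 2 + X 0 ^ 2)) fun y _ => by
        simpa using (mul_pos four_pos (gPos (y 0))).ne').congr fun y _ => by simp)
    (fun t _ => by
      simp only [hFdef, snoc_one_eq, snoc_zero_eq]
      exact (continuous_const.mul (by fun_prop)).div_const _ |>.continuousOn)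
    (fun t _ s _ => by
      simp only [hFdef, snoc_one_eq, snoc_zero_eq]
      have h := ((((hasDerivAt_id s).const_mul (15:ℝ)).sub ((hasDerivAt_pow 3 s).const_mul 10)).add
        ((hasDerivAt_pow 5 s).const_mul 3)).const_mul (q : ℝ) |>.div_const
        (60 * ((1 - t 0) ^ 2 + t 0 ^ 2))
      refine h.congr_deriv ?_
      have hG0 := (gPos (t 0)).ne'
      field_simp
      ring)
    (((continuous_swapWeight q).continuousOn.integrableOn_compact isCompact_Icc).mono_set
      band_ivSet_unit_subset_Icc)
    ((arcRep (4 * q / 15)).isSemialgebraicFunOn_integrand.congr fun t ht => (hbdry t ht).symm)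
    (((arcRep (4 * q / 15)).integrableOn.congr_fun (fun t ht => (hbdry t ht).symm)
      isSemialgebraic_ivSet.measurableSet_holds))
  obtain ⟨rb', hrb'd, hrb'i, hrel'⟩ := KZ.of_sub_of_restrict_openBand_mem_relations ha hb rb hrbd
  have hpin1 : KZ.of rb' - KZ.of ((pSqRep q).reindex (Equiv.swap 0 1)) ∈ KZ.relations := by
    refine KZ.of_sub_of_mem_relations_of_eqOn ?_ fun y _ => ?_
    · rw [hrb'd, swap_pSqRep_domain]
      ext y
      exact mem_sqSet_iff_init y
    · rw [hrb'i, hrbi, swap_pSqRep_integrand]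
  have hpin2 : KZ.of rd - KZ.of (arcRep (4 * q / 15)) ∈ KZ.relations := by
    refine KZ.of_sub_of_mem_relations_of_eqOn ?_ fun t ht => ?_
    · rw [arcRep_domain, hrdd]
    · rw [hrdi]
      rw [hrdd] at ht
      exact hbdry t ht
  have : KZ.of ((pSqRep q).reindex (Equiv.swap 0 1)) - KZ.of (arcRep (4 * q / 15)) =
      (KZ.of rb - KZ.of rd) - (KZ.of rb - KZ.of rb') -
        (KZ.of rb' - KZ.of ((pSqRep q).reindex (Equiv.swap 0 1))) +
          (KZ.of rd - KZ.of (arcRep (4 * q / 15))) := by abel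
  rw [this]
  exact add_mem (sub_mem (sub_mem hrel hrel') hpin1) hpin2

/-! #### Assembly: the paraboloid is in the weight-one class -/

/-- **`[(0,1)⁴ ∩ {x₃ > x₀² + x₁² + x₂²}, q] − arcRep (4q/15) ∈ KZ.relations`:** the paraboloid 4-cell
descends inside the rules to a RATIONAL 1-cell (six moves; `q·π/15` both sides).
[KontsevichZagier2001 §1.2; this node] -/
theorem of_cell_sub_of_arcRep_mem_relations (q : ℚ) :
    KZ.of (cellRep parab4Poly q) - KZ.of (arcRep (4 * q / 15)) ∈ KZ.relations := by
  have h1 := of_cell_sub_of_pSqRep_mem_relations q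
  have h2 := of_pSqRep_sub_of_swap_mem_relations q
  have h3 := of_swap_sub_of_arcRep_mem_relations q
  have : KZ.of (cellRep parab4Poly q) - KZ.of (arcRep (4 * q / 15)) =
      (KZ.of (cellRep parab4Poly q) - KZ.of (pSqRep q)) +
        (KZ.of (pSqRep q) - KZ.of ((pSqRep q).reindex (Equiv.swap 0 1))) +
          (KZ.of ((pSqRep q).reindex (Equiv.swap 0 1)) - KZ.of (arcRep (4 * q / 15))) := by abel
  rw [this]
  exact add_mem (add_mem h1 h2) h3

/-- **The solid paraboloid has weight one:** `QuadricBakerDescentAt parab4Poly` — decided INSIDE the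
rules. [KontsevichZagier2001 §1.2; this node] -/
theorem bakerDescentAt_parab4 : QuadricBakerDescentAt parab4Poly :=
  bakerDescentAt_of_cellRep fun _ q =>
    ⟨KZ.of (arcRep (4 * q / 15)),
      AddSubgroup.subset_closure ⟨1, arcRep (4 * q / 15), le_rfl, isRational_arcRep _, rfl⟩,
      of_cell_sub_of_arcRep_mem_relations q⟩

/-- **Conjecture 1 (kernel form) HOLDS for the paraboloid cells, unconditionally:** every vanishing
`ℤ`-combination of representations `[(0,1)⁴ ∩ {x₃ > x₀² + x₁² + x₂²}, qᵢ]` is a Kontsevich–Zagier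
relation (Baker, via the tree's dimension-`≤ 1` kernel theorem). [Baker1975 Thm 2.1;
KontsevichZagier2001 §1.2; this node] -/
theorem sum_mem_relations_parab4 (k : ℕ) (q : Fin k → ℚ) (ρ : Fin k → KZ.IntegralRep 4)
    (c : Fin k → ℤ)
    (hρ : ∀ i, (ρ i).domain = {x | (∀ j, 0 < x j ∧ x j < 1) ∧ 0 < MvPolynomial.aeval x parab4Poly} ∧
      ∀ x ∈ (ρ i).domain, (ρ i).integrand x = (q i : ℝ))
    (hv : KZ.eval (∑ i, c i • KZ.of (ρ i)) = 0) : (∑ i, c i • KZ.of (ρ i)) ∈ KZ.relations :=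
  sum_mem_relations_of_bakerDescentAt_single bakerDescentAt_parab4
    totalDegree_parab4Poly_le k q ρ c hρ hv

end Summit.KontsevichZagierPeriods.RootDecompWalshStrata.Parab4

end
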